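import Summits.BirchSwinnertonDyer.BirchSwinnertonDyer.Theorems.PrintCf2SplitBadTwoRestrictedControlOfResiduals
import HarnessLib

/-!
# Crux `PrintCf2.SplitBadTwoRankOneOfFacts` (stmt-BirchSwinnertonDyer-20368), road α v10.3 — S3c assembly, THIRD CUT (the robust one):
# `stub_restrictedControl_two` ⟸ (C1) ∧ (R-KER) ∧ (R-TOP′) ∧ (R-DYADIC) ∧ (R-SEVEN) ∧ (R-SURJ) ∧ (R-BV), the kernel and top terms as CLASS FUNCTIONS

Cell `bsd-print-cf2`, LEAD seat `bsd-line-cf2-p1` g12 (prover-bsd-line-cf2-p1-g12-0); `--supports stmt-BirchSwinnertonDyer-20368` (helper, Theses-free).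
HONEST FRAMING: proves the registered statement of S3c from DISPLAYED HYPOTHESES; nothing here is a named fact; BSD is not proved by any of this; no
summit statement is proved by this seat. No definition, no `sorry`.

WHY A THIRD CUT (and why it is the one to discharge against). Cuts 1–2 (p664178 `restrictedControl_two_of_residuals`, `…_split`) asked for the SHARP
values `#ker = 1` (via H7) and `#𝔖_Γ = 1` (B17). S3c itself needs LESS: only that `v₂ #ker` and `v₂ #𝔖_Γ` be functions of the class `[d]₂` — and at
`p = 2` the B17 input «`X_{v̄}(K*_∞, W*)` has no nonzero finite `Λ`-submodule» lacks its classical trigger (`W*[v̄](K) ≠ 0`; Greenberg LNM 1716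
Prop. 4.15 needs `E(K)[p] = 0`), so the assembly should survive `#𝔖_Γ = 2` as long as it is class-uniform. This cut therefore takes
 (C1) no odd place over `7d` splits completely in `K*_∞` (CFT; needed for the EXACT local kernels `#LK_w = 2`, -w3 g7/g8 — member-dependent places);
 (R-KER) `v₂ #ker = e_k([d]₂)` (-w6 g2: `= 0` under H7);  (R-TOP′) `v₂ #𝔖_Γ = e_Γ([d]₂)` given the f.g. datum with `HasCharValuationAt` (-w4 g8 B17: `= 0`);
 (R-DYADIC) `v₂ #LK_{v̄} = e_{v̄}([d]₂)` (-w2 g9 p664385: by name under two CFT-shaped local hypotheses);  (R-SEVEN) the `7 ∣ d` Tamagawa/torsion twin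
 (-w3 g8 p664173 + torsion twin);  (R-SURJ) EXACT cokernel `= ∏_{w∈T} #LK_w · #LK_{v̄}` (LEAD g12 `S3C-DEFECT-VANISHES-g12.md`: the defect's Poitou–Tate
 dual is `H¹_{str v}(K_Σ/K, T_v E) = 0` in rank one);  (R-BV) bottom value `v₂ #𝔖_{v̄}(K, W*) = v₂ #Ш(W/ℚ)[2^∞] + 2ℓ + e_K([d]₂)` (-w7 g2 three-factor
 snake + B6/B6e -w8 + dyadic index B2/T4),
and returns S3c VERBATIM with `e_C := e_K + e_{v̄} − e_k − e_Γ`. Kernel inputs by name as in cut 1 (-w7 four-index identity with all finiteness, -w3 g7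
`exists_finset_seven_mul`, -w3 g8 `sum_padicValNat_localKer_top_of_frame_add_two_eq`, c301 `torsionOrder_eq_two_of_smul_eq_cm7_quadraticTwist`, -w3 g7
finiteness of the local kernels). presearch: not applicable. beyond-print theorem: no.

References: [Agboola2007] §3 Prop. 3.2, §5, §6 Prop. 6.10–6.11, Prop. 8.1; [GreenbergLNM1716] §3 Lemmas 3.1–3.3, §4 Lemma 4.2, Prop. 4.14–4.15.
-/

noncomputable section

open scoped Classical

set_option linter.dupNamespace false
set_option autoImplicit false

open NumberField IsDedekindDomain Field WeierstrassCurve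
open Literature.NumberTheory.EllipticCurves Literature.NumberTheory.EllipticCurves.GreenbergSelmer
open Literature.NumberTheory.EllipticCurves.Agboola2007
open Literature.NumberTheory.EllipticCurves.IwasawaAlgebra
open Literature.NumberTheory.EllipticCurves.IwasawaDual
open Literature.NumberTheory.EllipticCurves.ResKernel
open Literature.NumberTheory.GaloisRepresentations
open Summit.BirchSwinnertonDyer.BirchSwinnertonDyer.Theorems.PrintCf2.AdditiveAtSeven
open Summit.BirchSwinnertonDyer.BirchSwinnertonDyer.Theorems.GoldfeldGoodTwists

namespace Summit.BirchSwinnertonDyer.BirchSwinnertonDyer.Theorems.PrintCf2.RestrictedSelmerPair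

/-- `v_p (∏_{i ∈ s} f i) = Σ_{i ∈ s} v_p (f i)` when no factor vanishes (`padicValNat.mul`, Finset induction). [folklore] -/
private theorem padicValNat_finset_prod' {ι : Type*} (p : ℕ) [Fact p.Prime] (s : Finset ι) (f : ι → ℕ)
    (hf : ∀ i ∈ s, f i ≠ 0) : padicValNat p (∏ i ∈ s, f i) = ∑ i ∈ s, padicValNat p (f i) := by
  induction s using Finset.induction_on with
  | empty => simp
  | insert a s ha ih =>
    rw [Finset.prod_insert ha, Finset.sum_insert ha,
      padicValNat.mul (hf a (Finset.mem_insert_self a s))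
        (Finset.prod_ne_zero_iff.mpr fun i hi ↦ hf i (Finset.mem_insert_of_mem hi)),
      ih fun i hi ↦ hf i (Finset.mem_insert_of_mem hi)]

/-- **S3c `stub_restrictedControl_two` — THIRD CUT: ⟸ (C1) ∧ (R-KER) ∧ (R-TOP′) ∧ (R-DYADIC) ∧ (R-SEVEN) ∧ (R-SURJ) ∧ (R-BV)**, the control kernel and
the top term entering only as class functions of `[d]₂`; `e_C := e_K + e_{v̄} − e_k − e_Γ`. [cite: Agboola2007, §3 Prop. 3.2, §5, §6 Prop. 6.10–6.11, Prop. 8.1]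
[cite: GreenbergLNM1716, §3 Lemmas 3.1–3.3, §4 Lemma 4.2] -/
theorem restrictedControl_two_of_residuals_classfun
    (hC1 : ∀ (K : Type) [Field K] [NumberField K], IsImaginaryQuadratic K →
      ∀ (vbar : HeightOneSpectrum (𝓞 K)), ((2 : ℕ) : 𝓞 K) ∈ vbar.asIdeal →
      ∀ (κ' : ZpExtension K 2), κ'.IsUnramifiedOutside vbar →
      ∀ (w : HeightOneSpectrum (𝓞 K)), ((2 : ℕ) : 𝓞 K) ∉ w.asIdeal → ¬ decomp w ≤ κ'.kerSubgroup)
    -- (R-KER) the control KERNEL is a function of the 2-adic class of `d` (= 0 under H7 «w₇ inert in K₁», -w6 g2 p661668-lineage)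
    (hKer : ∃ ek : ℤ → ℤ → ℤ, ∀ (d : ℤ), d ≠ 0 → Squarefree d → d % 4 ≠ 1 →
      ∀ (W : WeierstrassCurve ℚ) [W.IsElliptic] (C : VariableChange ℚ), C • W = cm7.quadraticTwist (d : ℚ) →
      ∀ (K : Type) [Field K] [NumberField K], IsImaginaryQuadratic K →
      ∀ (v vbar : HeightOneSpectrum (𝓞 K)),
        ((2 : ℕ) : 𝓞 K) ∈ v.asIdeal → ((2 : ℕ) : 𝓞 K) ∈ vbar.asIdeal → vbar ≠ v →
      ∀ (π : (W.baseChange K).endRing), (π : AddMonoid.End (W.baseChange K).geomPoints) * π = π - 2 →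
      ∀ (r : ℤ_[2]), r * r = r - 2 →
        (∀ τ ∈ GreenbergSelmer.inertia v, ∀ x : ↥((W.baseChange K).endEigenPrimaryTorsion 2 π r), τ • x = x ∨ τ • x = -x) →
      ∀ (κ' : ZpExtension K 2), κ'.IsUnramifiedOutside vbar → ∀ (γ' : absoluteGaloisGroup K), κ'.IsTopGenerator γ' →
        (padicValNat 2 (Nat.card ↥(restrictedSelmerBase ↥((W.baseChange K).endEigenPrimaryTorsion 2 π r) 2 vbar ⊓
          (resOfLe ↥((W.baseChange K).endEigenPrimaryTorsion 2 π r) (le_top : κ'.kerSubgroup ≤ ⊤)).ker)) : ℤ) = ek (d % 2) ((d / (2 - d % 2)) % 8))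
    -- (R-TOP′) `v₂ #𝔖_Γ` is a function of the 2-adic class of `d` on every frame with a f.g. dual datum with a characteristic valuation
    -- (= 0 under B17 «no nonzero finite Λ-submodule», -w4 g8; stated as a class function so that the assembly survives either outcome at p = 2)
    (hTop : ∃ eΓ : ℤ → ℤ → ℤ, ∀ (d : ℤ), d ≠ 0 → Squarefree d → d % 4 ≠ 1 →
      ∀ (W : WeierstrassCurve ℚ) [W.IsElliptic] (C : VariableChange ℚ), C • W = cm7.quadraticTwist (d : ℚ) →
      ∀ (K : Type) [Field K] [NumberField K], IsImaginaryQuadratic K →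
      ∀ (v vbar : HeightOneSpectrum (𝓞 K)),
        ((2 : ℕ) : 𝓞 K) ∈ v.asIdeal → ((2 : ℕ) : 𝓞 K) ∈ vbar.asIdeal → vbar ≠ v →
      ∀ (π : (W.baseChange K).endRing), (π : AddMonoid.End (W.baseChange K).geomPoints) * π = π - 2 →
      ∀ (r : ℤ_[2]), r * r = r - 2 →
        (∀ τ ∈ GreenbergSelmer.inertia v, ∀ x : ↥((W.baseChange K).endEigenPrimaryTorsion 2 π r), τ • x = x ∨ τ • x = -x) →
      ∀ (κ' : ZpExtension K 2), κ'.IsUnramifiedOutside vbar → ∀ (γ' : absoluteGaloisGroup K), κ'.IsTopGenerator γ' →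
      ∀ (D : Agboola2007.RestrictedDualData κ' ↥((W.baseChange K).endEigenPrimaryTorsion 2 π r) vbar γ') (n : ℕ),
        Module.Finite (IwasawaAlgebra 2) D.X → D.HasCharValuationAt n →
        (padicValNat 2 (Nat.card (EndCoinvariants (conjRestricted κ' ↥((W.baseChange K).endEigenPrimaryTorsion 2 π r) vbar γ' - 1))) : ℤ) =
          eΓ (d % 2) ((d / (2 - d % 2)) % 8))
    (hDy : ∃ ev : ℤ → ℤ → ℤ, ∀ (d : ℤ), d ≠ 0 → Squarefree d → d % 4 ≠ 1 →
      ∀ (W : WeierstrassCurve ℚ) [W.IsElliptic] (C : VariableChange ℚ), C • W = cm7.quadraticTwist (d : ℚ) →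
      ∀ (K : Type) [Field K] [NumberField K], IsImaginaryQuadratic K →
      ∀ (v vbar : HeightOneSpectrum (𝓞 K)),
        ((2 : ℕ) : 𝓞 K) ∈ v.asIdeal → ((2 : ℕ) : 𝓞 K) ∈ vbar.asIdeal → vbar ≠ v →
      ∀ (π : (W.baseChange K).endRing), (π : AddMonoid.End (W.baseChange K).geomPoints) * π = π - 2 →
      ∀ (r : ℤ_[2]), r * r = r - 2 →
        (∀ τ ∈ GreenbergSelmer.inertia v, ∀ x : ↥((W.baseChange K).endEigenPrimaryTorsion 2 π r), τ • x = x ∨ τ • x = -x) →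
      ∀ (κ' : ZpExtension K 2), κ'.IsUnramifiedOutside vbar →
        (padicValNat 2 (Nat.card (resOfLe ↥((W.baseChange K).endEigenPrimaryTorsion 2 π r)
          (inf_le_inf_right (decomp vbar) (le_top : κ'.kerSubgroup ≤ ⊤))).ker) : ℤ) = ev (d % 2) ((d / (2 - d % 2)) % 8))
    (hSeven : ∀ (d : ℤ), Squarefree d → d % 4 ≠ 1 → (7 : ℤ) ∣ d →
      ∀ (W : WeierstrassCurve ℚ) [W.IsElliptic] (C : VariableChange ℚ), C • W = cm7.quadraticTwist (d : ℚ) →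
      W.torsionOrder = 2 ∧
      ∀ (K : Type) [Field K] [NumberField K], IsImaginaryQuadratic K →
      ∀ (vbar : HeightOneSpectrum (𝓞 K)), ((2 : ℕ) : 𝓞 K) ∈ vbar.asIdeal →
      ∀ (π : (W.baseChange K).endRing), (π : AddMonoid.End (W.baseChange K).geomPoints) * π = π - 2 →
      ∀ (r : ℤ_[2]), r * r = r - 2 → ∀ (κ' : ZpExtension K 2), κ'.IsUnramifiedOutside vbar →
      ∀ (T : Finset (HeightOneSpectrum (𝓞 K))),
        (∀ w : HeightOneSpectrum (𝓞 K), w ∈ T ↔ ((2 : ℕ) : 𝓞 K) ∉ w.asIdeal ∧ ((7 * d : ℤ) : 𝓞 K) ∈ w.asIdeal) →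
        (∀ w ∈ T, ¬ decomp w ≤ κ'.kerSubgroup) →
        (∑ w ∈ T, padicValNat 2 (Nat.card (resOfLe ↥((W.baseChange K).endEigenPrimaryTorsion 2 π r)
          (inf_le_inf_right (decomp w) (le_top : κ'.kerSubgroup ≤ ⊤))).ker)) + 2 = padicValNat 2 W.tamagawaProduct)
    -- (R-SURJ) the lift map `res⁻¹(𝔖^Γ) → ⊕_{w ∈ T ∪ {v̄}} LK_w` is ONTO: the control cokernel IS the product of the local kernels
    (hSurj : ∀ (d : ℤ), d ≠ 0 → Squarefree d → d % 4 ≠ 1 →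
      ∀ (W : WeierstrassCurve ℚ) [W.IsElliptic] [W.IsGloballyMinimal] (C : VariableChange ℚ),
        C • W = cm7.quadraticTwist (d : ℚ) → W.analyticRank = 1 →
      ∀ (K : Type) [Field K] [NumberField K], IsImaginaryQuadratic K →
      ∀ (v vbar : HeightOneSpectrum (𝓞 K)),
        ((2 : ℕ) : 𝓞 K) ∈ v.asIdeal → ((2 : ℕ) : 𝓞 K) ∈ vbar.asIdeal → vbar ≠ v →
      ∀ (π : (W.baseChange K).endRing), (π : AddMonoid.End (W.baseChange K).geomPoints) * π = π - 2 →
      ∀ (r : ℤ_[2]), r * r = r - 2 →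
        (∀ τ ∈ GreenbergSelmer.inertia v, ∀ x : ↥((W.baseChange K).endEigenPrimaryTorsion 2 π r), τ • x = x ∨ τ • x = -x) →
      ∀ (κ' : ZpExtension K 2), κ'.IsUnramifiedOutside vbar → ∀ (γ' : absoluteGaloisGroup K), κ'.IsTopGenerator γ' →
      ∀ (T : Finset (HeightOneSpectrum (𝓞 K))),
        (∀ w : HeightOneSpectrum (𝓞 K), w ∈ T ↔ ((2 : ℕ) : 𝓞 K) ∉ w.asIdeal ∧ ((7 * d : ℤ) : 𝓞 K) ∈ w.asIdeal) →
        (((restrictedSelmerBase ↥((W.baseChange K).endEigenPrimaryTorsion 2 π r) 2 vbar).map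
            (resOfLe ↥((W.baseChange K).endEigenPrimaryTorsion 2 π r) (le_top : κ'.kerSubgroup ≤ ⊤))).addSubgroupOf
            (restrictedSelmerZp κ' ↥((W.baseChange K).endEigenPrimaryTorsion 2 π r) vbar)).relIndex
          (endInvariants (conjRestricted κ' ↥((W.baseChange K).endEigenPrimaryTorsion 2 π r) vbar γ' - 1)) =
        (∏ w ∈ T, Nat.card (resOfLe ↥((W.baseChange K).endEigenPrimaryTorsion 2 π r) (inf_le_inf_right (decomp w) (le_top : κ'.kerSubgroup ≤ ⊤))).ker) *
          Nat.card (resOfLe ↥((W.baseChange K).endEigenPrimaryTorsion 2 π r) (inf_le_inf_right (decomp vbar) (le_top : κ'.kerSubgroup ≤ ⊤))).ker)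
    -- (R-BV) the BOTTOM VALUE law: `v₂ #𝔖_{v̄}(K, W*) = v₂ #Ш(W/ℚ)[2^∞] + 2ℓ + e_K([d]₂)` (Agboola Prop. 6.10–6.11 + 8.1 at the additive prime)
    (hBV : ∃ eK : ℤ → ℤ → ℤ, ∀ (d : ℤ), d ≠ 0 → Squarefree d → d % 4 ≠ 1 →
      ∀ (W : WeierstrassCurve ℚ) [W.IsElliptic] [W.IsGloballyMinimal] (C : VariableChange ℚ),
        C • W = cm7.quadraticTwist (d : ℚ) → W.analyticRank = 1 →
      ∀ (K : Type) [Field K] [NumberField K], IsImaginaryQuadratic K →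
      ∀ (v vbar : HeightOneSpectrum (𝓞 K)),
        ((2 : ℕ) : 𝓞 K) ∈ v.asIdeal → ((2 : ℕ) : 𝓞 K) ∈ vbar.asIdeal → vbar ≠ v →
      ∀ (π : (W.baseChange K).endRing), (π : AddMonoid.End (W.baseChange K).geomPoints) * π = π - 2 →
      ∀ (r : ℤ_[2]), r * r = r - 2 →
        (∀ τ ∈ GreenbergSelmer.inertia v, ∀ x : ↥((W.baseChange K).endEigenPrimaryTorsion 2 π r), τ • x = x ∨ τ • x = -x) →
      ∀ (P : W.toAffine.Point) (c₀ : ℕ) (ℓ : ℤ),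
        ¬ IsOfFinAddOrder P →
        (∀ R : W.toAffine.Point, ∃ (k : ℤ) (T : W.toAffine.Point), IsOfFinAddOrder T ∧ R = k • P + T) →
        c₀ ≠ 0 → (W.baseChange ℚ_[2]).IsInReductionKernel (c₀ • W.toPadicPoint 2 P) →
        ‖(W.baseChange ℚ_[2]).padicLogPoint (c₀ • W.toPadicPoint 2 P) / (c₀ : ℚ_[2])‖ = (2 : ℝ) ^ (-ℓ) →
      Finite (restrictedSelmerBase ↥((W.baseChange K).endEigenPrimaryTorsion 2 π r) 2 vbar) →
        (padicValNat 2 (Nat.card (restrictedSelmerBase ↥((W.baseChange K).endEigenPrimaryTorsion 2 π r) 2 vbar)) : ℤ) =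
          (padicValNat 2 (Nat.card (AddCommGroup.primaryComponent W.sha 2)) : ℤ) + 2 * ℓ + eK (d % 2) ((d / (2 - d % 2)) % 8)) :
    -- CONCLUSION: S3c `stub_restrictedControl_two`, v9 = v10.3 VERBATIM
    -- CONCLUSION: S3c `stub_restrictedControl_two`, v9 = v10.3 VERBATIM
    ∃ eC : ℤ → ℤ → ℤ,
    ∀ (d : ℤ), d ≠ 0 → Squarefree d → d % 4 ≠ 1 →
    ∀ (W : WeierstrassCurve ℚ) [W.IsElliptic] [W.IsGloballyMinimal] (C : VariableChange ℚ),
      C • W = cm7.quadraticTwist (d : ℚ) → W.analyticRank = 1 →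
    ∀ (K : Type) [Field K] [NumberField K], IsImaginaryQuadratic K →
    ∀ (v vbar : HeightOneSpectrum (𝓞 K)),
      ((2 : ℕ) : 𝓞 K) ∈ v.asIdeal → ((2 : ℕ) : 𝓞 K) ∈ vbar.asIdeal → vbar ≠ v →
    ∀ (π : (W.baseChange K).endRing), (π : AddMonoid.End (W.baseChange K).geomPoints) * π = π - 2 →
    ∀ (r : ℤ_[2]), r * r = r - 2 →
      (∀ τ ∈ GreenbergSelmer.inertia v, ∀ x : ↥((W.baseChange K).endEigenPrimaryTorsion 2 π r), τ • x = x ∨ τ • x = -x) →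
    ∀ (κ' : ZpExtension K 2), κ'.IsUnramifiedOutside vbar → ∀ (γ' : absoluteGaloisGroup K), κ'.IsTopGenerator γ' →
    ∀ (D : Agboola2007.RestrictedDualData κ' ↥((W.baseChange K).endEigenPrimaryTorsion 2 π r) vbar γ') (n : ℕ),
      Module.Finite (IwasawaAlgebra 2) D.X → D.HasCharValuationAt n →
    ∀ (P : W.toAffine.Point) (c₀ : ℕ) (ℓ : ℤ),
      ¬ IsOfFinAddOrder P →
      (∀ R : W.toAffine.Point, ∃ (k : ℤ) (T : W.toAffine.Point), IsOfFinAddOrder T ∧ R = k • P + T) →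
      c₀ ≠ 0 → (W.baseChange ℚ_[2]).IsInReductionKernel (c₀ • W.toPadicPoint 2 P) →
      ‖(W.baseChange ℚ_[2]).padicLogPoint (c₀ • W.toPadicPoint 2 P) / (c₀ : ℚ_[2])‖ = (2 : ℝ) ^ (-ℓ) →
      (n : ℤ) = ((padicValNat 2 (Nat.card (AddCommGroup.primaryComponent W.sha 2)) : ℤ)
            + (padicValNat 2 W.tamagawaProduct : ℤ)
            - 2 * (padicValNat 2 W.torsionOrder : ℤ) + 2 * ℓ) + eC (d % 2) ((d / (2 - d % 2)) % 8) := by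
  obtain ⟨ek, hek⟩ := hKer
  obtain ⟨eΓ, heΓ⟩ := hTop
  obtain ⟨ev, hev⟩ := hDy
  obtain ⟨eK, heK⟩ := hBV
  refine ⟨fun a b ↦ eK a b + ev a b - ek a b - eΓ a b, ?_⟩
  intro d hd0 hsq hd4 W _ _ C hC hrk K _ _ hK v vbar hv hvbar hne π hrel r hr hpin κ' hκ' γ' hγ' D n hDf hDn
    P c₀ ℓ hP hgen hc₀ hker hlog
  haveI : (W.baseChange K).IsElliptic := inferInstanceAs ((W.map (algebraMap ℚ K)).IsElliptic)
  haveI := hDf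
  -- 1. the four-index identity with all finiteness
  obtain ⟨hfinI, hfinC, hfinB, hfinK, hid⟩ :=
    hasCharValuationAt_control_identity_endEigenPrimaryTorsion (W.baseChange K) 2 π r κ' hγ' vbar D hDn
  -- 2./3. kernel and top terms as class functions
  have hkerZ := hek d hd0 hsq hd4 W C hC K hK v vbar hv hvbar hne π hrel r hr hpin κ' hκ' γ' hγ'
  have htopZ := heΓ d hd0 hsq hd4 W C hC K hK v vbar hv hvbar hne π hrel r hr hpin κ' hκ' γ' hγ' D n hDf hDn
  -- 4. places `T`, Tamagawa dictionary, torsion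
  obtain ⟨T, hT⟩ := exists_finset_seven_mul (K := K) hd0
  have hC1T : ∀ w ∈ T, ¬ decomp w ≤ κ'.kerSubgroup := fun w hw ↦ hC1 K hK vbar hvbar κ' hκ' w ((hT w).mp hw).1
  have hTam : (∑ w ∈ T, padicValNat 2 (Nat.card (resOfLe ↥((W.baseChange K).endEigenPrimaryTorsion 2 π r) (inf_le_inf_right (decomp w) (le_top : κ'.kerSubgroup ≤ ⊤))).ker)) + 2 =
      padicValNat 2 W.tamagawaProduct ∧ W.torsionOrder = 2 := by
    by_cases h7 : (7 : ℤ) ∣ d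
    · obtain ⟨htors, hlaw⟩ := hSeven d hsq hd4 h7 W C hC
      exact ⟨hlaw K hK vbar hvbar π hrel r hr κ' hκ' T hT hC1T, htors⟩
    · exact ⟨sum_padicValNat_localKer_top_of_frame_add_two_eq hsq hd4 h7 W C hC hK vbar hvbar π hrel hr κ' hκ' T hT hC1T,
        torsionOrder_eq_two_of_smul_eq_cm7_quadraticTwist hsq hd4 h7 W C hC⟩
  obtain ⟨hTamEq, htors⟩ := hTam
  -- 5. dyadic value, 6. exact cokernel and bottom value
  have hdy := hev d hd0 hsq hd4 W C hC K hK v vbar hv hvbar hne π hrel r hr hpin κ' hκ'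
  have hsurj := hSurj d hd0 hsq hd4 W C hC hrk K hK v vbar hv hvbar hne π hrel r hr hpin κ' hκ' γ' hγ' T hT
  have hbv := heK d hd0 hsq hd4 W C hC hrk K hK v vbar hv hvbar hne π hrel r hr hpin P c₀ ℓ hP hgen hc₀ hker hlog hfinB
  have hT0 : ∀ w ∈ T, Nat.card (resOfLe ↥((W.baseChange K).endEigenPrimaryTorsion 2 π r)
      (inf_le_inf_right (decomp w) (le_top : κ'.kerSubgroup ≤ ⊤))).ker ≠ 0 := by
    intro w hw
    obtain ⟨h2w, h7d⟩ := (hT w).mp hw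
    haveI := (finite_and_natCard_localKer_top_of_frame_le_two hd0 hsq W C hC hK vbar hvbar π hrel hr κ' hκ' h2w h7d).1
    exact Nat.card_pos.ne'
  have hvbar0 : Nat.card (resOfLe ↥((W.baseChange K).endEigenPrimaryTorsion 2 π r)
      (inf_le_inf_right (decomp vbar) (le_top : κ'.kerSubgroup ≤ ⊤))).ker ≠ 0 := by
    haveI := (finite_and_natCard_localKer_top_vbar_of_frame_le_four hd0 W C hC hK hv hvbar hne π hrel hr κ').1
    exact Nat.card_pos.ne'
  have hrelv : padicValNat 2 ((((restrictedSelmerBase ↥((W.baseChange K).endEigenPrimaryTorsion 2 π r) 2 vbar).map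
      (resOfLe ↥((W.baseChange K).endEigenPrimaryTorsion 2 π r) (le_top : κ'.kerSubgroup ≤ ⊤))).addSubgroupOf
      (restrictedSelmerZp κ' ↥((W.baseChange K).endEigenPrimaryTorsion 2 π r) vbar)).relIndex
      (endInvariants (conjRestricted κ' ↥((W.baseChange K).endEigenPrimaryTorsion 2 π r) vbar γ' - 1))) =
      (∑ w ∈ T, padicValNat 2 (Nat.card (resOfLe ↥((W.baseChange K).endEigenPrimaryTorsion 2 π r)
        (inf_le_inf_right (decomp w) (le_top : κ'.kerSubgroup ≤ ⊤))).ker)) +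
      padicValNat 2 (Nat.card (resOfLe ↥((W.baseChange K).endEigenPrimaryTorsion 2 π r)
        (inf_le_inf_right (decomp vbar) (le_top : κ'.kerSubgroup ≤ ⊤))).ker) := by
    rw [hsurj, padicValNat.mul (Finset.prod_ne_zero_iff.mpr hT0) hvbar0, padicValNat_finset_prod' 2 T _ hT0]
  -- 7. arithmetic
  have htors2 : (padicValNat 2 W.torsionOrder : ℤ) = 1 := by
    rw [htors]; simp
  have hidZ := congrArg (fun m : ℕ ↦ (m : ℤ)) hid
  have hTamZ := congrArg (fun m : ℕ ↦ (m : ℤ)) hTamEq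
  have hrelvZ := congrArg (fun m : ℕ ↦ (m : ℤ)) hrelv
  dsimp only at hidZ hTamZ hrelvZ ⊢
  push_cast at hidZ hTamZ hrelvZ hbv hdy hkerZ htopZ htors2 ⊢
  linarith

end Summit.BirchSwinnertonDyer.BirchSwinnertonDyer.Theorems.PrintCf2.RestrictedSelmerPair

end
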